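import Summits.BirchSwinnertonDyer.BirchSwinnertonDyer.Theorems.SignedLowerHalvesSmallImageLowerHalfBothSignsRttReciprocityUnique
import Summits.BirchSwinnertonDyer.BirchSwinnertonDyer.Theorems.ResidualThetaTransportAtTwoPollackPairKUnique
import HarnessLib

/-!
# Route `SignedLowerHalves`, crux L `SmallImageLowerHalfBothSigns` (stmt-BirchSwinnertonDyer-23599), line `rtt_w3` v30 — row S4′ (`stub_junctionReciprocity_ns`), brick β7 (core), LEAD g14, part 2:
# THE SKELETON'S `hcongr` CONGRUENCES PIN AN ELEMENT OF `𝒪⟦T⟧` (`eq_of_forall_isCongrModOmegaO`)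

Sequel of `…RttReciprocityUnique` (§1–§3) and of the tree's `…ResidualThetaTransportAtTwoPollackPairKUnique` (lead `bsd-wall-rtt-p2` g13: the `𝒪`-Pollack pair is unique —
`PollackPairK.dvd_sub_of_isCongrModOmegaO`, `…not_isUnit_natCast_padicCoeffIntegers`, `…isDiscreteValuationRing_padicCoeffIntegers`, which this file REUSES). HERE: in the EXACT
shape of the skeleton's hypothesis `hcongr` of line `rtt_w3` — `IsCongrModOmegaO S n (θ n) ((((-1)^(n/2+1) · ω_n^∓).map ι) · ι L)` for every `n` with `Even n ↔ ε = 1` — two integral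
solutions `A, B ∈ 𝒪⟦T⟧` are EQUAL (`𝒪 = padicCoeffIntegers S`, `ℚ_p(S)/ℚ_p` finite). Steps: two solutions of ONE congruence differ by a multiple of `X·ω_n^{±}` in `𝒪⟦T⟧`
(`PollackPairK.dvd_sub_of_isCongrModOmegaO`, `ω_n = (X·ω_n^±)·ω_n^∓`), and §3 of part 1 (`eq_zero_of_forall_even_X_mul_cyclotomicOmegaPlus_dvd` / `…odd…Minus…`, with a uniformizer
`ϖ ∣ p` of the DVR `𝒪`). USE: brick β7 of S4′ (MEMO `Lines/rtt_w3-MEMO-S4prime-lead-g14.md`): once `c·Col^ε(jv(s ζ̄_𝔞))` satisfies the congruences that `d·L` satisfies, `c·Col(…) = d·L`;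
and LEAD g13's disprover question (i) «is `L` pinned by `hcongr`?» — YES (★★★ `eq_of_forall_isCongrModOmegaO`).
THEOREMS ONLY (`--supports stmt-BirchSwinnertonDyer-23599` helper); closes nothing; S4′, crux L and BSD remain OPEN and are proved for NO curve by any of this.
[cite: Pollack2003, §6.5 Prop. 6.18] [cite: Sprung2017, Thm. 1.12 (uniqueness)] [cite: Kobayashi2003, Thm. 6.3] [cite: Washington1997, §7.1] [folklore]
-/

set_option autoImplicit false
-- the Theorems namespace of this sub repeats the summit name by design (D-0017 nested layout)
set_option linter.dupNamespace false

noncomputable section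

open Polynomial
open Literature.NumberTheory.EllipticCurves
open Summit.BirchSwinnertonDyer.BirchSwinnertonDyer.Theorems.PollackPairK

namespace Summit.BirchSwinnertonDyer.BirchSwinnertonDyer.Theorems.SmallImageRttReciprocity

variable {p : ℕ} [hp : Fact p.Prime] (S : Set (PadicAlgCl p)) [FiniteDimensional ℚ_[p] (padicCoeffField S)]

/-- A uniformizer `ϖ` of `𝒪 = padicCoeffIntegers S`: prime, `⋂ ϖ^j 𝒪 = 0`, and `ϖ ∣ p` (the three inputs of part 1's §3). [folklore] -/
theorem exists_uniformizer_dvd_natCast :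
    ∃ ϖ : padicCoeffIntegers S, Prime ϖ ∧ (∀ x : padicCoeffIntegers S, (∀ j : ℕ, ϖ ^ j ∣ x) → x = 0) ∧ ϖ ∣ ((p : ℕ) : padicCoeffIntegers S) := by
  haveI : IsDiscreteValuationRing (padicCoeffIntegers S) := isDiscreteValuationRing_padicCoeffIntegers
  obtain ⟨ϖ, hϖ⟩ := IsDiscreteValuationRing.exists_irreducible (padicCoeffIntegers S)
  refine ⟨ϖ, hϖ.prime, ?_, ?_⟩
  · intro x hx
    have hmax : IsLocalRing.maximalIdeal (padicCoeffIntegers S) = Ideal.span {ϖ} := (IsDiscreteValuationRing.irreducible_iff_uniformizer ϖ).mp hϖ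
    have hmem : x ∈ ⨅ i : ℕ, (IsLocalRing.maximalIdeal (padicCoeffIntegers S)) ^ i := by
      refine Ideal.mem_iInf.mpr fun i ↦ ?_
      rw [hmax, Ideal.span_singleton_pow]
      exact Ideal.mem_span_singleton.mpr (hx i)
    rwa [Ideal.iInf_pow_eq_bot_of_isLocalRing _ (IsLocalRing.maximalIdeal.isMaximal _).ne_top, Ideal.mem_bot] at hmem
  · have hmem : ((p : ℕ) : padicCoeffIntegers S) ∈ IsLocalRing.maximalIdeal (padicCoeffIntegers S) := not_isUnit_natCast_padicCoeffIntegers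
    rw [(IsDiscreteValuationRing.irreducible_iff_uniformizer ϖ).mp hϖ, Ideal.mem_span_singleton] at hmem
    exact hmem

/-- ★★★ **The line's congruences PIN `L`**: if `A, B ∈ 𝒪⟦T⟧` (`𝒪 = padicCoeffIntegers S`, `ℚ_p(S)` finite over `ℚ_p`) both satisfy the `hcongr` congruences of the skeleton —
`θ_n ≡ (−1)^{n/2+1}·ω_n^∓·L (mod ω_n)` in `𝒪⟦T⟧ ⊗ ℚ` for every `n` of parity `ε` (`IsCongrModOmegaO`, with `ω_n^- = cyclotomicOmegaMinus` when `ε = 1`, `ω_n^+` when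
`ε = −1`) — then `A = B`: the difference is divisible by `X·ω_n^±` for all `n` of parity `ε` (`PollackPairK.dvd_sub_of_isCongrModOmegaO`), hence `0` (part 1, §3). Brick β7 of
S4′ and LEAD g13's disprover question (i). [cite: Pollack2003, §6.5 Prop. 6.18] [cite: Sprung2017, Thm. 1.12 (uniqueness)] [cite: Kobayashi2003, Thm. 6.3] -/
theorem eq_of_forall_isCongrModOmegaO (ε : ℤˣ) (θ : ℕ → (PadicAlgCl p)[X]) {A B : IwasawaAlgebraO S}
    (hA : ∀ n : ℕ, (Even n ↔ ε = 1) → IsCongrModOmegaO S n (θ n)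
      (((((-1) ^ (n / 2 + 1) * (if ε = 1 then cyclotomicOmegaMinus p n else cyclotomicOmegaPlus p n)).map (Int.castRingHom (PadicAlgCl p)) :
          (PadicAlgCl p)[X]) : PowerSeries (PadicAlgCl p)) * iwasawaOToPowerSeries S A))
    (hB : ∀ n : ℕ, (Even n ↔ ε = 1) → IsCongrModOmegaO S n (θ n)
      (((((-1) ^ (n / 2 + 1) * (if ε = 1 then cyclotomicOmegaMinus p n else cyclotomicOmegaPlus p n)).map (Int.castRingHom (PadicAlgCl p)) :
          (PadicAlgCl p)[X]) : PowerSeries (PadicAlgCl p)) * iwasawaOToPowerSeries S B)) : A = B := by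
  obtain ⟨ϖ, hϖ, hK, hϖp⟩ := exists_uniformizer_dvd_natCast S
  have hsign : ∀ n : ℕ, ((-1 : ℤ[X]) ^ (n / 2 + 1)) = 1 ∨ ((-1 : ℤ[X]) ^ (n / 2 + 1)) = -1 := fun n ↦ neg_one_pow_eq_or ℤ[X] (n / 2 + 1)
  rw [← sub_eq_zero, show A - B = -(B - A) from (neg_sub B A).symm, neg_eq_zero]
  rcases Int.units_eq_one_or ε with rfl | rfl
  · -- `ε = 1`: even `n`, multiplier `±ω_n^-`, divisor `X·ω_n^+`
    refine eq_zero_of_forall_even_X_mul_cyclotomicOmegaPlus_dvd hϖ hK hϖp fun n hn ↦ ?_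
    have hn' : Even n ↔ (1 : ℤˣ) = 1 := ⟨fun _ ↦ rfl, fun _ ↦ hn⟩
    have hA' := hA n hn'
    have hB' := hB n hn'
    simp only [if_true] at hA' hB'
    exact dvd_sub_of_isCongrModOmegaO S (hsign n) (monic_X.mul (monic_cyclotomicOmegaPlus p _)) (monic_cyclotomicOmegaMinus p _)
      (X_mul_cyclotomicOmegaPlus_mul_cyclotomicOmegaMinus p n).symm hA' hB'
  · -- `ε = −1`: odd `n`, multiplier `±ω_n^+`, divisor `X·ω_n^-`
    refine eq_zero_of_forall_odd_X_mul_cyclotomicOmegaMinus_dvd hϖ hK hϖp fun n hn ↦ ?_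
    have hne : ((-1 : ℤˣ) = 1) ↔ False := ⟨fun h ↦ by simp at h, False.elim⟩
    have hn' : Even n ↔ (-1 : ℤˣ) = 1 := by rw [hne, iff_false]; exact Nat.not_even_iff_odd.mpr hn
    have hA' := hA n hn'
    have hB' := hB n hn'
    simp only [hne, if_false] at hA' hB'
    exact dvd_sub_of_isCongrModOmegaO S (hsign n) (monic_X.mul (monic_cyclotomicOmegaMinus p _)) (monic_cyclotomicOmegaPlus p _)
      (by rw [← X_mul_cyclotomicOmegaPlus_mul_cyclotomicOmegaMinus]; ring) hA' hB'

/-- **Scaled form for brick β7**: if `c·A` and `d·B` (`c, d ∈ 𝒪`) satisfy the SAME congruences (e.g. `d·θ_n ≡ s_n ω_n^∓·(c·Col(jv(s ζ̄_𝔞)))` from the reciprocity side and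
`d·θ_n ≡ s_n ω_n^∓·(d·L)` from `hcongr` scaled by `d`), then `c·A = d·B`. A restatement of `eq_of_forall_isCongrModOmegaO` for the products. [cite: Pollack2003, §6.5 Prop. 6.18] -/
theorem C_mul_eq_C_mul_of_forall_isCongrModOmegaO (ε : ℤˣ) (θ : ℕ → (PadicAlgCl p)[X]) (c d : padicCoeffIntegers S) {A B : IwasawaAlgebraO S}
    (hA : ∀ n : ℕ, (Even n ↔ ε = 1) → IsCongrModOmegaO S n (θ n)
      (((((-1) ^ (n / 2 + 1) * (if ε = 1 then cyclotomicOmegaMinus p n else cyclotomicOmegaPlus p n)).map (Int.castRingHom (PadicAlgCl p)) :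
          (PadicAlgCl p)[X]) : PowerSeries (PadicAlgCl p)) * iwasawaOToPowerSeries S (PowerSeries.C c * A)))
    (hB : ∀ n : ℕ, (Even n ↔ ε = 1) → IsCongrModOmegaO S n (θ n)
      (((((-1) ^ (n / 2 + 1) * (if ε = 1 then cyclotomicOmegaMinus p n else cyclotomicOmegaPlus p n)).map (Int.castRingHom (PadicAlgCl p)) :
          (PadicAlgCl p)[X]) : PowerSeries (PadicAlgCl p)) * iwasawaOToPowerSeries S (PowerSeries.C d * B))) :
    PowerSeries.C c * A = PowerSeries.C d * B :=
  eq_of_forall_isCongrModOmegaO S ε θ hA hB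

end Summit.BirchSwinnertonDyer.BirchSwinnertonDyer.Theorems.SmallImageRttReciprocity
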